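import Mathlib
import Literature.Computability.Complexity.CliqueTestGraphs
import Summits.PneNP.PneNP.Theorems.ConvexRankGatesConvexGateBlindFactorisation

/-!
# PneNP / ConvexRankGates — `ConvexGateBlind`: a CONV gate for CLIQUE factorises the clique-distance matrix through PSD ⊕ ℝ₊

Helpers (`--supports stmt-PneNP-10680`): the SDP version of `…CliqueDistance.lean`. If ONE CONV gate
`x ↦ [∃ Y ⪰ 0 (q × q), tr(Aᵢ Y) ≤ bᵢ + ∑ₑ Bᵢₑ [xₑ]]` (`B ≥ 0`, `p` rows) computes `CLIQUE(m, k)`, then for some `ε > 0`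
the shifted canonical matrix `D - εJ`, `D[Q,u] = #(E(Q) ∖ u)` (`Q` the `k`-sets, `u` the `k`-clique-free graphs),
factorises through the cone `PSD_q × ℝ^L_{≥0}`, `#L = p + 2 #E + 3`:
  `D[Q,u] - ε = tr(H'_u Y_Q) + ∑_{l ∈ L} U_{u,l} V_{l,Q}`,  `H'_u, Y_Q ⪰ 0`, `U, V ≥ 0`
(`convGate_cliqueDist_coneFactorisation`). No duality beyond the trace-normalised Farkas certificates of
`convGate_certificate_factorisation` is needed: with `w_u = Bᵀy_u`, `W_u = 1 + ∑ w_u`, `H'_u = W_u⁻¹ H_u`,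
`ε_u = (θ_u - w_u·u)/W_u`, the identity
`W_u D[Q,u] - (θ_u - w_u·u) = (w_u·1_Q - θ_u) + ∑_{e ∉ u}(W_u - w_u(e))[e ∈ Q] + ∑_{e ∈ u} w_u(e)[e ∉ Q]` and the
exact form of weak duality `w_u·1_Q - θ_u = tr(H_u Y_Q) + y_u·s_Q + λ_u t_Q` do it. With the converse
(`exists_convData_of_factorisation`, `…Converse.lean`) this yields the canonical form of the whole crux
(`…CanonicalForm.lean`). [folklore; the CLIQUE/SDP analogue of Hrubeš 2020 (`Hrubes2020`), Thm. 20]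
-/

namespace Summit.PneNP.PneNP.Theorems

open Matrix Finset Literature.Computability.Complexity

/-- **A CONV gate computing CLIQUE factorises `D - εJ` through `PSD_q ⊕ ℝ₊`** (`D[Q,u] = #(E(Q) ∖ u)`): some
`ε > 0`, PSD matrices `H'_u` (for clique-free `u`) and `Y_Q` (for `k`-sets `Q`), and non-negative `U, V` over
`(Fin p ⊕ Unit) ⊕ ((E ⊕ E) ⊕ Unit)` with `D[Q,u] - ε = tr(H'_u Y_Q) + ∑_l U_{u,l} V_{l,Q}`. [folklore] -/
theorem convGate_cliqueDist_coneFactorisation {m k p q : ℕ} (A : Fin p → Matrix (Fin q) (Fin q) ℝ)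
    (b : Fin p → ℝ) (B : Fin p → (⊤ : SimpleGraph (Fin m)).edgeSet → ℝ) (hB : ∀ i e, 0 ≤ B i e)
    (hcomp : ∀ x : (⊤ : SimpleGraph (Fin m)).edgeSet → Bool, cliqueFn m k x = true ↔
      ∃ Z : Matrix (Fin q) (Fin q) ℝ, Z.PosSemidef ∧
        ∀ i, (A i * Z).trace ≤ b i + ∑ e, B i e * (if x e then (1 : ℝ) else 0)) :
    ∃ ε : ℝ, 0 < ε ∧ ∃ (H' : ((⊤ : SimpleGraph (Fin m)).edgeSet → Bool) → Matrix (Fin q) (Fin q) ℝ) (Y' : Finset (Fin m) → Matrix (Fin q) (Fin q) ℝ)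
      (U : ((⊤ : SimpleGraph (Fin m)).edgeSet → Bool) → ((Fin p ⊕ Unit) ⊕ (((⊤ : SimpleGraph (Fin m)).edgeSet ⊕ (⊤ : SimpleGraph (Fin m)).edgeSet) ⊕ Unit)) → ℝ) (V : ((Fin p ⊕ Unit) ⊕ (((⊤ : SimpleGraph (Fin m)).edgeSet ⊕ (⊤ : SimpleGraph (Fin m)).edgeSet) ⊕ Unit)) → Finset (Fin m) → ℝ),
      (∀ u, cliqueFn m k u = false → (H' u).PosSemidef) ∧
      (∀ Q : Finset (Fin m), Q.card = k → (Y' Q).PosSemidef) ∧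
      (∀ u l, 0 ≤ U u l) ∧ (∀ l Q, 0 ≤ V l Q) ∧
      ∀ (Q : Finset (Fin m)) (u : (⊤ : SimpleGraph (Fin m)).edgeSet → Bool), Q.card = k → cliqueFn m k u = false →
        (∑ e, if cliqueVec Q e = true ∧ u e = false then (1 : ℝ) else 0) - ε =
          (H' u * Y' Q).trace + ∑ l, U u l * V l Q := by
  classical
  obtain ⟨R, y, lam, w, θ, H, Y, s, t, hR, hw, hθ, -, hrej, hacc⟩ := convGate_certificate_factorisation A b B hB
  -- rejected = clique-free, accepted ⊇ clique vectors
  have hrej' : ∀ u : (⊤ : SimpleGraph (Fin m)).edgeSet → Bool, cliqueFn m k u = false →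
      ¬ ∃ Z : Matrix (Fin q) (Fin q) ℝ, Z.PosSemidef ∧
        ∀ i, (A i * Z).trace ≤ b i + ∑ e, B i e * (if u e then (1 : ℝ) else 0) := by
    intro u hu hZ
    have h := (hcomp u).2 hZ
    rw [hu] at h
    exact Bool.noConfusion h
  have hacc' : ∀ Q : Finset (Fin m), Q.card = k → ∃ Z : Matrix (Fin q) (Fin q) ℝ, Z.PosSemidef ∧
      ∀ i, (A i * Z).trace ≤ b i + ∑ e, B i e * (if cliqueVec Q e then (1 : ℝ) else 0) :=
    fun Q hQ => (hcomp _).1 (cliqueFn_cliqueVec hQ.ge)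
  -- derived data
  let W : ((⊤ : SimpleGraph (Fin m)).edgeSet → Bool) → ℝ := fun u => 1 + ∑ e, w u e
  let εu : ((⊤ : SimpleGraph (Fin m)).edgeSet → Bool) → ℝ := fun u => (θ u - ∑ e, w u e * (if u e then (1 : ℝ) else 0)) / W u
  have hw0 : ∀ u, cliqueFn m k u = false → ∀ e, 0 ≤ w u e := fun u hu e => (hrej u (hrej' u hu)).2.2.1 e
  have hW : ∀ u, cliqueFn m k u = false → 0 < W u := by
    intro u hu
    have : 0 ≤ ∑ e, w u e := Finset.sum_nonneg fun e _ => hw0 u hu e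
    simp only [W]
    linarith
  have hwW : ∀ u, cliqueFn m k u = false → ∀ e, w u e ≤ W u := by
    intro u hu e
    have : w u e ≤ ∑ e, w u e := Finset.single_le_sum (fun e _ => hw0 u hu e) (Finset.mem_univ e)
    simp only [W]
    linarith
  have hεu : ∀ u, cliqueFn m k u = false → 0 < εu u := by
    intro u hu
    have h := (hrej u (hrej' u hu)).2.2.2.2
    exact div_pos (by linarith) (hW u hu)
  -- the uniform margin
  have hε : ∃ ε : ℝ, 0 < ε ∧ ∀ u, cliqueFn m k u = false → ε ≤ εu u := by
    by_cases hex : ∃ u : (⊤ : SimpleGraph (Fin m)).edgeSet → Bool, cliqueFn m k u = false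
    · have hne : (univ.filter fun u : (⊤ : SimpleGraph (Fin m)).edgeSet → Bool => cliqueFn m k u = false).Nonempty := by
        obtain ⟨u, hu⟩ := hex
        exact ⟨u, Finset.mem_filter.2 ⟨Finset.mem_univ _, hu⟩⟩
      obtain ⟨u₀, hu₀, hmin⟩ := Finset.exists_min_image _ εu hne
      exact ⟨εu u₀, hεu u₀ (Finset.mem_filter.1 hu₀).2, fun u hu =>
        hmin u (Finset.mem_filter.2 ⟨Finset.mem_univ _, hu⟩)⟩
    · exact ⟨1, one_pos, fun u hu => absurd ⟨u, hu⟩ hex⟩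
  obtain ⟨ε, hε0, hεle⟩ := hε
  refine ⟨ε, hε0, ?_⟩
  -- the factors (zero outside the relevant rows / columns)
  let Hf : ((⊤ : SimpleGraph (Fin m)).edgeSet → Bool) → Matrix (Fin q) (Fin q) ℝ := fun u => (1 / W u) • H u
  let Yf : Finset (Fin m) → Matrix (Fin q) (Fin q) ℝ := fun Q => Y (cliqueVec Q)
  let Uf : ((⊤ : SimpleGraph (Fin m)).edgeSet → Bool) → ((Fin p ⊕ Unit) ⊕ (((⊤ : SimpleGraph (Fin m)).edgeSet ⊕ (⊤ : SimpleGraph (Fin m)).edgeSet) ⊕ Unit)) → ℝ := fun u l => if cliqueFn m k u = false then Sum.elim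
      (Sum.elim (fun i => y u i / W u) (fun _ => lam u / W u))
      (Sum.elim (Sum.elim (fun e => if u e then 0 else (W u - w u e) / W u)
        (fun e => if u e then w u e / W u else 0)) (fun _ => εu u - ε)) l else 0
  let Vf : ((Fin p ⊕ Unit) ⊕ (((⊤ : SimpleGraph (Fin m)).edgeSet ⊕ (⊤ : SimpleGraph (Fin m)).edgeSet) ⊕ Unit)) → Finset (Fin m) → ℝ := fun l Q => if Q.card = k then Sum.elim
      (Sum.elim (fun i => s (cliqueVec Q) i) (fun _ => t (cliqueVec Q)))
      (Sum.elim (Sum.elim (fun e => if cliqueVec Q e then (1 : ℝ) else 0)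
        (fun e => if cliqueVec Q e then (0 : ℝ) else 1)) (fun _ => 1)) l else 0
  refine ⟨Hf, Yf, Uf, Vf, fun u hu => ?_, fun Q hQ => (hacc _ (hacc' Q hQ)).1, fun u l => ?_, fun l Q => ?_,
    fun Q u hQ hu => ?_⟩
  · exact (hrej u (hrej' u hu)).2.2.2.1.smul (by have := hW u hu; positivity)
  · by_cases hu : cliqueFn m k u = false
    · simp only [Uf, if_pos hu]
      rcases l with (i | _) | ((e | e) | _)
      · exact div_nonneg ((hrej u (hrej' u hu)).1 i) (hW u hu).le
      · exact div_nonneg (hrej u (hrej' u hu)).2.1 (hW u hu).le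
      · simp only [Sum.elim_inl, Sum.elim_inr]
        split_ifs
        · exact le_rfl
        · exact div_nonneg (by linarith [hwW u hu e]) (hW u hu).le
      · simp only [Sum.elim_inl, Sum.elim_inr]
        split_ifs
        · exact div_nonneg (hw0 u hu e) (hW u hu).le
        · exact le_rfl
      · simp only [Sum.elim_inr, sub_nonneg]
        exact hεle u hu
    · simp only [Uf, if_neg hu]
      exact le_rfl
  · by_cases hQ : Q.card = k
    · simp only [Vf, if_pos hQ]
      rcases l with (i | _) | ((e | e) | _)
      · exact (hacc _ (hacc' Q hQ)).2.2.1 i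
      · exact (hacc _ (hacc' Q hQ)).2.2.2.1
      · simp only [Sum.elim_inl, Sum.elim_inr]
        split_ifs <;> norm_num
      · simp only [Sum.elim_inl, Sum.elim_inr]
        split_ifs <;> norm_num
      · simp only [Sum.elim_inr]
        norm_num
    · simp only [Vf, if_neg hQ]
      exact le_rfl
  · -- the identity `D[Q,u] - ε = tr(H' Y) + ∑ U V`
    have hWpos := hW u hu
    have hWne : W u ≠ 0 := hWpos.ne'
    have hdual := (hacc _ (hacc' Q hQ)).2.2.2.2.2.2 u
    simp only [Hf, Yf, Uf, Vf, if_pos hu, if_pos hQ, Fintype.sum_sum_type, Sum.elim_inl, Sum.elim_inr,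
      Finset.univ_unique, Finset.sum_singleton, Matrix.smul_mul, Matrix.trace_smul, smul_eq_mul]
    -- first block: weak duality made exact
    have S1 : 1 / W u * (H u * Y (cliqueVec Q)).trace + (∑ i, y u i / W u * s (cliqueVec Q) i +
        lam u / W u * t (cliqueVec Q)) =
        (∑ e, w u e * (if cliqueVec Q e then (1 : ℝ) else 0) - θ u) / W u := by
      rw [hdual]
      simp only [add_div, Finset.sum_div]
      have : ∑ i, y u i / W u * s (cliqueVec Q) i = ∑ i, y u i * s (cliqueVec Q) i / W u :=
        Finset.sum_congr rfl fun i _ => by ring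
      rw [this]
      ring
    -- second block: edge by edge
    have S2 : ∀ e : (⊤ : SimpleGraph (Fin m)).edgeSet, (if u e then 0 else (W u - w u e) / W u) * (if cliqueVec Q e then (1 : ℝ) else 0) +
        (if u e then w u e / W u else 0) * (if cliqueVec Q e then (0 : ℝ) else 1) =
        (W u * (if cliqueVec Q e = true ∧ u e = false then (1 : ℝ) else 0)
          - w u e * (if cliqueVec Q e then (1 : ℝ) else 0) + w u e * (if u e then (1 : ℝ) else 0)) / W u := by
      intro e
      cases hue : u e <;> cases hQe : cliqueVec Q e <;> simp
    have S2sum : ∑ e : (⊤ : SimpleGraph (Fin m)).edgeSet, ((if u e then 0 else (W u - w u e) / W u) * (if cliqueVec Q e then (1 : ℝ) else 0)) +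
        ∑ e : (⊤ : SimpleGraph (Fin m)).edgeSet, ((if u e then w u e / W u else 0) * (if cliqueVec Q e then (0 : ℝ) else 1)) =
        (W u * (∑ e, if cliqueVec Q e = true ∧ u e = false then (1 : ℝ) else 0)
          - ∑ e, w u e * (if cliqueVec Q e then (1 : ℝ) else 0) + ∑ e, w u e * (if u e then (1 : ℝ) else 0)) / W u := by
      rw [← Finset.sum_add_distrib, Finset.sum_congr rfl fun e _ => S2 e, ← Finset.sum_div, Finset.sum_add_distrib,
        Finset.sum_sub_distrib, Finset.mul_sum]
    have hgoal : 1 / W u * (H u * Y (cliqueVec Q)).trace +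
        (∑ i, y u i / W u * s (cliqueVec Q) i + lam u / W u * t (cliqueVec Q) +
          ((∑ e : (⊤ : SimpleGraph (Fin m)).edgeSet, ((if u e then 0 else (W u - w u e) / W u) * (if cliqueVec Q e then (1 : ℝ) else 0)) +
              ∑ e : (⊤ : SimpleGraph (Fin m)).edgeSet, ((if u e then w u e / W u else 0) * (if cliqueVec Q e then (0 : ℝ) else 1))) +
            (εu u - ε) * 1)) =
        (∑ e, if cliqueVec Q e = true ∧ u e = false then (1 : ℝ) else 0) - ε := by
      rw [S2sum, mul_one, ← add_assoc, ← add_assoc, S1]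
      simp only [εu]
      field_simp
      ring
    linarith [hgoal]

end Summit.PneNP.PneNP.Theorems
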